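import Mathlib
import Summits.ValiantsHypothesis.ValiantsHypothesis.Theorems.BarrierLeverSuccinctHittingSetsForVPSpskTwo
import HarnessLib

/-!
# Crux `BarrierLever.DefinableEquations` (stmt-ValiantsHypothesis-8745) / item 8749
`SingleSizeEquations` — the `ΣΠΣ(k)` WALL at the open rung: no Boolean-sum witness is a depth-3
`ΣΠΣ` polynomial of top fan-in `k ≤ n/4` (at `b ≥ 2`) or `k ≤ n` (at `b ≥ 3`)

Seat val-np-p5 g17 (docket 8745/8746/8749). In the crux's currency — a witness of
`SingleSizeEquations` at `(n, b)` is `E = boolSum H ≠ 0` vanishing on `coeff(SmallCircuits ℂ n b)` —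
the 14610-side theorem `isSuccinctHittingSet_spsk_of_budget` (`…SpskTwo`, today) says:

* `boolSum_witness_not_spsk_two` : for `n ≥ 3`, `4k ≤ n`, `b ≥ 2`, NO witness `E` (any `q`, any size and
  degree of `H`) equals a `ΣΠΣ(k)` polynomial `Σ_{i<k} ∏_j ℓ_{ij}` with affine `ℓ_{ij}` in the
  coefficient variables (any number of factors, any degree) — so at the OPEN rung `b = 2` a witness is
  not depth-3 of top fan-in `≤ n/4 = Θ(log N)` (g16 had `k = 2`);
* `boolSum_witness_not_spsk_three` : for `n ≥ 4`, `k ≤ n`, `b ≥ 3`, the same for every `k ≤ n`.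

Door table (memo LANDSCAPE-8749-g16 §5 / g17 §0): "E a ΣΠΣ(k) circuit": CLOSED at `b = 2` for
`k ≤ n/4` and at `b ≥ 3` for `k ≤ n`; poly(N) top fan-in remains OPEN (the obstruction is the seed
count `k` of the Shpilka–Volkovich-type generator = the size `k(3n+3)` of its realisation).

Honest framing: a WALL; verdict on 8745/8749 unchanged (OPEN at `b = 2`); nothing here bears on
`VP ≠ VNP`.

References: [SaxenaSeshadhri2012] Lemma 11; [ForbesShpilkaVolk2018] Cor. 22, Question 6;
[ChatterjeeTengse2023] §1.3.
-/

-- layout Summits/ValiantsHypothesis/ValiantsHypothesis forces the duplicated namespace component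
set_option linter.dupNamespace false

noncomputable section

namespace Summit.ValiantsHypothesis.ValiantsHypothesis.Theorems.BarrierLeverDefinableEquations

open Literature.Barriers.ValiantsHypothesis Literature.Computability.AlgebraicComplexity MvPolynomial
open Summit.ValiantsHypothesis.ValiantsHypothesis.Theorems.BarrierLever.SuccinctHittingSetsForVP

namespace SpskWall

/-- **No Boolean-sum witness at `(n, b)`, `b ≥ 2`, `n ≥ 3`, is a `ΣΠΣ(k)` polynomial with `4k ≤ n`.**
[cite: ForbesShpilkaVolk2018, Cor. 22] -/
theorem boolSum_witness_not_spsk_two {n b q k : ℕ} (hn : 3 ≤ n) (hk : 4 * k ≤ n) (hb : 2 ≤ b)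
    (H : MvPolynomial (degLEMonomials n ⊕ Fin q) ℂ) (hne : boolSum H ≠ 0)
    (hvan : ∀ f ∈ SmallCircuits ℂ n b,
      MvPolynomial.eval (coeffVector (degLEMonomials n) f) (boolSum H) = 0) :
    ¬ ∃ (dd : Fin k → ℕ) (ℓ : (i : Fin k) → Fin (dd i) → MvPolynomial (degLEMonomials n) ℂ),
        (∀ i j, (ℓ i j).totalDegree ≤ 1) ∧ boolSum H = ∑ i, ∏ j, ℓ i j := by
  intro hshape
  obtain ⟨f, hf, hf0⟩ := isSuccinctHittingSet_spsk_two hn hk (boolSum H) hshape hne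
  exact hf0 (hvan f (smallCircuits_mono ℂ hb (by omega) hf))

/-- **No Boolean-sum witness at `(n, b)`, `b ≥ 3`, `n ≥ 4`, is a `ΣΠΣ(k)` polynomial with `k ≤ n`.**
[cite: ForbesShpilkaVolk2018, Cor. 22] -/
theorem boolSum_witness_not_spsk_three {n b q k : ℕ} (hn : 4 ≤ n) (hk : k ≤ n) (hb : 3 ≤ b)
    (H : MvPolynomial (degLEMonomials n ⊕ Fin q) ℂ) (hne : boolSum H ≠ 0)
    (hvan : ∀ f ∈ SmallCircuits ℂ n b,
      MvPolynomial.eval (coeffVector (degLEMonomials n) f) (boolSum H) = 0) :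
    ¬ ∃ (dd : Fin k → ℕ) (ℓ : (i : Fin k) → Fin (dd i) → MvPolynomial (degLEMonomials n) ℂ),
        (∀ i j, (ℓ i j).totalDegree ≤ 1) ∧ boolSum H = ∑ i, ∏ j, ℓ i j := by
  intro hshape
  obtain ⟨f, hf, hf0⟩ := isSuccinctHittingSet_spsk_three hn hk (boolSum H) hshape hne
  exact hf0 (hvan f (smallCircuits_mono ℂ hb (by omega) hf))

end SpskWall

end Summit.ValiantsHypothesis.ValiantsHypothesis.Theorems.BarrierLeverDefinableEquations

end
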